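import Summits.AnomalousDissipation.AnomalousDissipation.Theorems.MomentParityQuarticGateRowPoly
import Summits.AnomalousDissipation.AnomalousDissipation.Theorems.MomentParityQuarticGateBudget
import Literature.FieldTheory.QuasiAlgClosed.Basic

/-!
# `stub_cubicCasimir` for the crux `MomentParity.CubicParityLoud`, line `farkas-split-menu`
# (stmt-AnomalousDissipation-11465): the cubic part of a weak certificate vanishes

Stub S2 of the lead skeleton `Cruxes/CubicParityLoud/Lines/farkas-split-menu.lean`, in the clause
vocabulary `T3 R3 H3 L2T3 IsLevel IsBandTest polyGrad` of
`…Theorems.CubicParityLoud.Negative.Clauses`.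

A WEAK CERTIFICATE at `(f, ν, N, E, ε)` is a polynomial cylindrical test `(g, P)` — level-`N` band
test fields `gᵢ`, `deg P ≤ 2` — and multipliers `λ_b, λ_c ∈ ℝ` (no sign needed here) with
`⟨F_ν(u), ∇p(u)⟩ + λ_b (E − ‖u‖²) + λ_c (ν‖∇u‖² − ε) ≤ 0` at EVERY level-`N` field `u ∈ H`.
`stub_cubicCasimir` ("order 3 is free", dual form): then the quadratic part
`p₂ = homogeneousComponent 2 P` of the test is a quadratic CASIMIR of level-`N` Galerkin–Euler, i.e.
its Euler derivative `⟨B(u,u), ∇p₂(u)⟩ = Torus.nsGeneratorPairing 0 0 u (∇p₂(u))` vanishes at every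
level-`N` field.

Proof (all infrastructure from the sibling crux `QuarticGate`, namespace
`…Theorems.MomentParityQuarticGate`). In an orthonormal band basis `b` of `V_N` (`exists_bandBasis`)
the row `u ↦ ⟨F_ν(u), ∇p(u)⟩` of the test is, on level-`N` fields, a polynomial `Q` of degree `≤ 3`
in the coordinates `xᵢ = (u, bᵢ)` whose cubic component evaluates to `⟨B(u,u), ∇p₂(u)⟩`
(`exists_rowPoly`); the dissipation is a quadratic form `‖∇u‖² = D(x)` (`exists_dissipationPoly`);
and every `x ∈ ℝⁿ` is the coordinate vector of a level-`N` field with `‖u‖² = Σ xᵢ²`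
(`exists_level_of_coords`). So the certificate is the polynomial inequality
`Q(x) + λ_b (E − Σ xᵢ²) + λ_c (ν D(x) − ε) ≤ 0` on ALL of `ℝⁿ`. Along a ray `t ↦ t • x` it is a real
cubic in `t` (homogeneity scaling `MvPolynomial.IsHomogeneous.eval_smul_eq` of the homogeneous
components, `Literature.FieldTheory.QuasiAlgClosed.Basic`) with leading coefficient `Q₃(x)`, and a
real cubic bounded above on `ℝ` has zero leading coefficient (`cubic_leading_eq_zero`). Hence
`Q₃ ≡ 0` on `ℝⁿ`, which at the coordinates of the given level-`N` field is the claim.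

`farkasSplitMenu_cubicCasimir` is the same statement spelled without the named argument
`(d := Fin 3)` (type ascription on the zero force instead) — the spelling registered on the crux item,
proved `:= stub_cubicCasimir`.
-/

-- `Summit.<Summit>.<Problem>` is the tree's mandated summit-side namespace (CONVENTIONS §2); for this
-- single-conjunct summit the two coincide, so the duplicate is deliberate.
set_option linter.dupNamespace false

namespace Summit.AnomalousDissipation.AnomalousDissipation.Theorems.MomentParityCubicParityLoud

open MeasureTheory Filter UnitAddTorus
open scoped InnerProductSpace RealInnerProductSpace ENNReal
open Literature.Analysis.FunctionSpaces Literature.Analysis.FluidPDE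
open Summit.AnomalousDissipation.AnomalousDissipation.Theses.MomentParity
open Summit.AnomalousDissipation.AnomalousDissipation.Theorems.CubicParityLoud.Negative
open Summit.AnomalousDissipation.AnomalousDissipation.Theorems.MomentParityQuarticGate

/-! ## Real cubics bounded above have zero leading coefficient -/

/-- A real cubic with positive leading coefficient is positive somewhere: at
`t = (|b| + |c| + |d|) / a + 1 ≥ 1` one has `a t³ + b t² + c t + d ≥ t² (a t − |b| − |c| − |d|) > 0`.
[folklore] -/
theorem exists_cubic_pos {a : ℝ} (b c d : ℝ) (ha : 0 < a) :
    ∃ t : ℝ, 0 < a * t ^ 3 + b * t ^ 2 + c * t + d := by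
  refine ⟨(|b| + |c| + |d|) / a + 1, ?_⟩
  set t : ℝ := (|b| + |c| + |d|) / a + 1 with ht
  have hM : 0 ≤ (|b| + |c| + |d|) / a := by positivity
  have ht1 : 1 ≤ t := by rw [ht]; linarith
  have ht0 : 0 ≤ t := by linarith
  have htt : t ≤ t ^ 2 := by nlinarith
  have hat : |b| + |c| + |d| < a * t := by
    rw [ht, mul_add, mul_div_cancel₀ _ ha.ne', mul_one]; linarith
  have hb : -|b| * t ^ 2 ≤ b * t ^ 2 := mul_le_mul_of_nonneg_right (neg_abs_le b) (sq_nonneg t)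
  have hc : -|c| * t ^ 2 ≤ c * t := by
    have h1 := mul_le_mul_of_nonneg_left htt (abs_nonneg c)
    have h2 := mul_le_mul_of_nonneg_right (neg_abs_le c) ht0
    linarith
  have hd : -|d| * t ^ 2 ≤ d := by
    have h1 := mul_le_mul_of_nonneg_left (show (1 : ℝ) ≤ t ^ 2 by nlinarith) (abs_nonneg d)
    linarith [neg_abs_le d]
  have hkey : 0 < t ^ 2 * (a * t - (|b| + |c| + |d|)) :=
    mul_pos (pow_pos (by linarith) 2) (sub_pos.2 hat)
  nlinarith [hkey, hb, hc, hd]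

/-- **A real cubic bounded above on `ℝ` has zero leading coefficient**: if
`a t³ + b t² + c t + d ≤ 0` for all real `t` then `a = 0` (apply `exists_cubic_pos` to the cubic,
resp. to its reflection `t ↦ −t`). [folklore] -/
theorem cubic_leading_eq_zero {a b c d : ℝ}
    (h : ∀ t : ℝ, a * t ^ 3 + b * t ^ 2 + c * t + d ≤ 0) : a = 0 := by
  by_contra ha
  rcases lt_or_gt_of_ne ha with ha | ha
  · obtain ⟨t, ht⟩ := exists_cubic_pos b (-c) d (neg_pos.2 ha)
    have h' := h (-t)
    linarith
  · obtain ⟨t, ht⟩ := exists_cubic_pos b c d ha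
    linarith [h t]

/-! ## S2 — the cubic part of a weak certificate vanishes -/

/-- **S2 — `stub_cubicCasimir`: THE CUBIC PART OF A WEAK CERTIFICATE VANISHES ("order 3 is free",
dual form).** If `⟨F_ν(u), ∇p(u)⟩ + λ_b (E − ‖u‖²) + λ_c (ν‖∇u‖² − ε) ≤ 0` at every level-`N` field
for a test `(g, P)` with level-`N` band test fields and `deg P ≤ 2` (no sign condition on `λ_b, λ_c`),
then the quadratic part `p₂ = homogeneousComponent 2 P` of the test is a QUADRATIC CASIMIR of
level-`N` Galerkin–Euler: `Torus.nsGeneratorPairing 0 0 u (∇p₂(u)) = ⟨B(u,u), ∇p₂(u)⟩ = 0` at every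
level-`N` field `u`.
Proof: in orthonormal band coordinates the certificate is a real polynomial inequality
`Q(x) + λ_b (E − Σ xᵢ²) + λ_c (ν D(x) − ε) ≤ 0` on all of `ℝⁿ` with `deg Q ≤ 3`, `deg D = 2`
(`exists_bandBasis`, `exists_rowPoly`, `exists_dissipationPoly`, `exists_level_of_coords`); along rays
`t • x` it is a real cubic in `t` with leading coefficient `Q₃(x)` (`IsHomogeneous.eval_smul_eq`), so
`Q₃ ≡ 0` (`cubic_leading_eq_zero`), and `Q₃(x(u)) = ⟨B(u,u), ∇p₂(u)⟩` (`exists_rowPoly`). [folklore] -/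
theorem stub_cubicCasimir :
    ∀ f : T3 → R3, Torus.IsSmooth f → ∀ (ν : ℝ) (N : ℕ) (E ε lb lc : ℝ)
      (m : ℕ) (g : Fin m → T3 → R3) (P : MvPolynomial (Fin m) ℝ),
      (∀ i, IsBandTest N (g i)) → P.totalDegree ≤ 2 →
      (∀ u : H3, IsLevel N u →
          Torus.nsGeneratorPairing ν f u (polyGrad g P u) + lb * (E - ‖u‖ ^ 2) +
            lc * (ν * (Torus.eGradNormSq ((u : L2T3) : T3 → R3)).toReal - ε) ≤ 0) →
      ∀ u : H3, IsLevel N u →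
        Torus.nsGeneratorPairing (d := Fin 3) 0 0 u
          (polyGrad g (MvPolynomial.homogeneousComponent 2 P) u) = 0 := by
  intro f hf ν N E ε lb lc m g P hg hP hineq u₀ hu₀
  -- (1) orthonormal band basis, row polynomial `Q` (degree `≤ 3`), dissipation form `D`
  obtain ⟨n, b, hb, hbo, hbs⟩ := exists_bandBasis N
  obtain ⟨Q, hQdeg, hQrow, hQtop⟩ := exists_rowPoly hb hbo hbs ν f hf m g hg P 2 hP
  obtain ⟨D, hDh, hD⟩ := exists_dissipationPoly hb hbo hbs
  -- (2) the certificate is a polynomial inequality on all of `ℝⁿ` (coordinates are onto)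
  have hcert : ∀ x : Fin n → ℝ, MvPolynomial.eval x Q + lb * (E - ∑ i, x i ^ 2) +
      lc * (ν * MvPolynomial.eval x D - ε) ≤ 0 := by
    intro x
    obtain ⟨u, hu, hux, hun, -⟩ := exists_level_of_coords hb hbo x
    have h1 : Torus.nsGeneratorPairing ν f u (polyGrad g P u) = MvPolynomial.eval x Q := by
      rw [← hux]; exact hQrow u hu
    have h2 : (Torus.eGradNormSq ((u : L2T3) : T3 → R3)).toReal = MvPolynomial.eval x D := by
      rw [← hux]; exact hD u hu
    calc MvPolynomial.eval x Q + lb * (E - ∑ i, x i ^ 2) + lc * (ν * MvPolynomial.eval x D - ε)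
        = Torus.nsGeneratorPairing ν f u (polyGrad g P u) + lb * (E - ‖u‖ ^ 2) +
            lc * (ν * (Torus.eGradNormSq ((u : L2T3) : T3 → R3)).toReal - ε) := by
          rw [h1, h2, hun]
      _ ≤ 0 := hineq u hu
  -- (3) `Q` is the sum of its homogeneous components of degrees `0, …, 3`
  have hQsum : ∑ i ∈ Finset.range 4, MvPolynomial.homogeneousComponent i Q = Q := by
    conv_rhs => rw [← MvPolynomial.sum_homogeneousComponent Q]
    refine (Finset.sum_subset (Finset.range_subset_range.2 (by omega)) fun i _ hi => ?_).symm
    exact MvPolynomial.homogeneousComponent_eq_zero i Q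
      (by simp only [Finset.mem_range, not_lt] at hi; omega)
  -- (4) scaling along rays: `Q(t • x) = Σⱼ tʲ Qⱼ(x)`, `Σ (t xᵢ)² = t² Σ xᵢ²`, `D(t • x) = t² D(x)`
  have hevalQ : ∀ (x : Fin n → ℝ) (t : ℝ), MvPolynomial.eval (t • x) Q =
      MvPolynomial.eval x (MvPolynomial.homogeneousComponent 0 Q) +
        t * MvPolynomial.eval x (MvPolynomial.homogeneousComponent 1 Q) +
        t ^ 2 * MvPolynomial.eval x (MvPolynomial.homogeneousComponent 2 Q) +
        t ^ 3 * MvPolynomial.eval x (MvPolynomial.homogeneousComponent 3 Q) := by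
    intro x t
    have hscale : ∀ i, MvPolynomial.eval (t • x) (MvPolynomial.homogeneousComponent i Q) =
        t ^ i * MvPolynomial.eval x (MvPolynomial.homogeneousComponent i Q) := fun i =>
      (MvPolynomial.homogeneousComponent_isHomogeneous i Q).eval_smul_eq t x
    conv_lhs => rw [← hQsum, map_sum]
    simp only [Finset.sum_range_succ, Finset.sum_range_zero, zero_add, hscale, pow_zero, one_mul,
      pow_one]
  have hsq : ∀ (x : Fin n → ℝ) (t : ℝ), ∑ i, (t • x) i ^ 2 = t ^ 2 * ∑ i, x i ^ 2 := by
    intro x t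
    simp only [Pi.smul_apply, smul_eq_mul, mul_pow, Finset.mul_sum]
  -- (5) the cubic component of `Q` vanishes identically on `ℝⁿ`
  have hcubic : ∀ x : Fin n → ℝ,
      MvPolynomial.eval x (MvPolynomial.homogeneousComponent 3 Q) = 0 := by
    intro x
    refine cubic_leading_eq_zero
      (b := MvPolynomial.eval x (MvPolynomial.homogeneousComponent 2 Q) - lb * ∑ i, x i ^ 2 +
        lc * ν * MvPolynomial.eval x D)
      (c := MvPolynomial.eval x (MvPolynomial.homogeneousComponent 1 Q))
      (d := MvPolynomial.eval x (MvPolynomial.homogeneousComponent 0 Q) + lb * E - lc * ε)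
      fun t => ?_
    have h := hcert (t • x)
    rw [hevalQ, hsq, hDh.eval_smul_eq] at h
    linarith
  -- (6) conclusion at the given level-`N` field: `⟨B(u,u), ∇p₂(u)⟩ = Q₃(x(u)) = 0`
  exact (hQtop u₀ hu₀).symm.trans (hcubic _)

/-- **S2 — `stub_cubicCasimir`, `:=`-free spelling** (registered sub-goal `farkasSplitMenu_cubicCasimir`
of stmt-AnomalousDissipation-11465). The statement of `stub_cubicCasimir` with the implicit dimension of
`Torus.nsGeneratorPairing` pinned by a type ascription on the zero force instead of the named argument
`(d := Fin 3)`; the two statements elaborate to the same proposition. This spelling is the one the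
crux item's stub registry can store (it cuts signatures at the first `:=`, so the registered
`stub_cubicCasimir` entry ends mid-term and cannot be matched by any file). [folklore] -/
theorem farkasSplitMenu_cubicCasimir :
    ∀ f : T3 → R3, Torus.IsSmooth f → ∀ (ν : ℝ) (N : ℕ) (E ε lb lc : ℝ)
      (m : ℕ) (g : Fin m → T3 → R3) (P : MvPolynomial (Fin m) ℝ),
      (∀ i, IsBandTest N (g i)) → P.totalDegree ≤ 2 →
      (∀ u : H3, IsLevel N u →
          Torus.nsGeneratorPairing ν f u (polyGrad g P u) + lb * (E - ‖u‖ ^ 2) +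
            lc * (ν * (Torus.eGradNormSq ((u : L2T3) : T3 → R3)).toReal - ε) ≤ 0) →
      ∀ u : H3, IsLevel N u →
        Torus.nsGeneratorPairing 0 (0 : T3 → R3) u
          (polyGrad g (MvPolynomial.homogeneousComponent 2 P) u) = 0 :=
  stub_cubicCasimir

end Summit.AnomalousDissipation.AnomalousDissipation.Theorems.MomentParityCubicParityLoud
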